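import Literature.GroupTheory.Solvable.GeneralizedFittingSubgroupSubnormal
import Literature.GroupTheory.Solvable.LayerCentralProduct
import HarnessLib

/-!
# `F*(C_G(E(G))) = F(G)` and `F*(C_G(F(G))) = Z(F(G)) E(G)`
# (Kurzweil–Stellmacher §6.5, Exercise 1)

Topic `Literature/GroupTheory/Solvable`, namespace `Literature.GroupTheory.Solvable` (lane
`lit-hodgefound`, prover p30, row g40-#16).  Rests on 6.5.7 (b)
(`inf_generalizedFittingSubgroup_eq_map`, `GeneralizedFittingSubgroupSubnormal.lean`),
`[F(G), E(G)] = 1` (`fittingSubgroup_le_centralizer_layer`) and `Z(E(G)) ⊴ G`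
(`layer_inf_centralizer_normal`, `LayerCentralProduct.lean`).  Everything here is **proved**;
theorems only, no definition, no named fact.

Source, verbatim.  H. Kurzweil, B. Stellmacher, *The Theory of Finite Groups. An Introduction*,
Universitext, Springer 2004 (held `book:kurzweilnd-theory-finite-groups`, chunk p0087, p. 144),
§6.5, Exercises: "Let `G` be a group.  1. Describe `F*(C_G(E(G)))` and `F*(C_G(F(G)))`."

The exercise asks for a description; the answers proved here are
`F*(C_G(E(G))) = F(G)` and `F*(C_G(F(G))) = Z(F(G)) E(G)`.  Both follow from 6.5.7 (b)
(`F*(N) = F*(G) ∩ N` for `N ⊴ G`), `F*(G) = F(G) E(G)`, `[F(G), E(G)] = 1` and the Dedekind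
identity, together with `Z(E(G)) ≤ F(G)` (an Abelian normal subgroup).

Formalization notes.  For a subgroup `C ≤ G`, `F*(C)` viewed in `G` is
`(generalizedFittingSubgroup C).map C.subtype`; `C_G(X) = Subgroup.centralizer X`; `Z(F(G))` viewed
in `G` is `F(G) ∩ C_G(F(G))` (`inf_centralizer_eq_map_center` identifies it with the image of
`Subgroup.center (fittingSubgroup G)`).

## References

* H. Kurzweil, B. Stellmacher, *The Theory of Finite Groups. An Introduction*, Universitext,
  Springer 2004, §6.5 Exercise 1, p. 144 (with 6.5.7, p. 143). [KurzweilStellmacher2004]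
-/

namespace Literature.GroupTheory.Solvable

open Literature.GroupTheory.Nilpotent

variable {G : Type} [Group G]

/-- `H ∩ C_G(H) = Z(H)` (viewed in `G`). [folklore; used for §6.5 Exercise 1]
[cite: KurzweilStellmacher2004, §6.5 Exercise 1, p. 144] -/
theorem inf_centralizer_eq_map_center (H : Subgroup G) :
    H ⊓ Subgroup.centralizer (H : Set G) = (Subgroup.center H).map H.subtype := by
  ext x
  constructor
  · intro hx
    obtain ⟨hxH, hxC⟩ := Subgroup.mem_inf.mp hx
    refine ⟨⟨x, hxH⟩, Subgroup.mem_center_iff.mpr fun y => Subtype.ext ?_, rfl⟩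
    exact Subgroup.mem_centralizer_iff.mp hxC y y.2
  · rintro ⟨y, hy, rfl⟩
    refine Subgroup.mem_inf.mpr ⟨y.2, Subgroup.mem_centralizer_iff.mpr fun z hz => ?_⟩
    exact congrArg Subtype.val (Subgroup.mem_center_iff.mp hy ⟨z, hz⟩)

/-- `[F(G), E(G)] = 1` read as `E(G) ≤ C_G(F(G))`. [cite: KurzweilStellmacher2004, §6.5, p. 143] -/
theorem layer_le_centralizer_fittingSubgroup [Finite G] :
    layer G ≤ Subgroup.centralizer (fittingSubgroup G : Set G) := by
  rw [← Subgroup.commutator_eq_bot_iff_le_centralizer, Subgroup.commutator_comm]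
  exact commutator_fittingSubgroup_layer_eq_bot

/-- **`Z(E(G)) ≤ F(G)`**: `E(G) ∩ C_G(E(G))` is an Abelian normal subgroup of `G`.
[cite: KurzweilStellmacher2004, §6.5 Exercise 1, p. 144] -/
theorem layer_inf_centralizer_le_fittingSubgroup [Finite G] :
    layer G ⊓ Subgroup.centralizer (layer G : Set G) ≤ fittingSubgroup G := by
  haveI := layer_inf_centralizer_normal (G := G)
  have hab : IsMulCommutative (layer G ⊓ Subgroup.centralizer (layer G : Set G) : Subgroup G) :=
    ⟨⟨fun a b => Subtype.ext ((Subgroup.mem_centralizer_iff.mp (Subgroup.mem_inf.mp b.2).2) a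
      (Subgroup.mem_inf.mp a.2).1)⟩⟩
  haveI : Group.IsNilpotent (layer G ⊓ Subgroup.centralizer (layer G : Set G) : Subgroup G) :=
    ⟨⟨1, by rw [Subgroup.upperCentralSeries_one]; exact Subgroup.center_eq_top_iff.mpr hab⟩⟩
  exact le_fittingSubgroup _

/-- **§6.5 Exercise 1, first part: `F*(C_G(E(G))) = F(G)`.**
[cite: KurzweilStellmacher2004, §6.5 Exercise 1, p. 144] -/
theorem map_subtype_generalizedFittingSubgroup_centralizer_layer [Finite G] :
    (generalizedFittingSubgroup (Subgroup.centralizer (layer G : Set G))).map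
        (Subgroup.centralizer (layer G : Set G)).subtype = fittingSubgroup G := by
  haveI := layer_normal (G := G)
  haveI : (Subgroup.centralizer (layer G : Set G)).Normal := Subgroup.normal_centralizer
  rw [← inf_generalizedFittingSubgroup_eq_map]
  apply le_antisymm
  · -- `C ∩ F(G)E(G) = F(G) (C ∩ E(G)) = F(G) Z(E(G)) = F(G)` (Dedekind)
    intro x hx
    obtain ⟨hxC, hxF⟩ := Subgroup.mem_inf.mp hx
    rw [← SetLike.mem_coe, coe_generalizedFittingSubgroup] at hxF
    obtain ⟨f, hf, e, he, rfl⟩ := Set.mem_mul.mp hxF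
    have heC : e ∈ Subgroup.centralizer (layer G : Set G) := by
      have h := mul_mem (inv_mem (fittingSubgroup_le_centralizer_layer hf)) hxC
      rwa [inv_mul_cancel_left] at h
    exact mul_mem hf (layer_inf_centralizer_le_fittingSubgroup (Subgroup.mem_inf.mpr ⟨he, heC⟩))
  · refine le_inf fittingSubgroup_le_centralizer_layer ?_
    show fittingSubgroup G ≤ fittingSubgroup G ⊔ layer G
    exact le_sup_left

/-- **§6.5 Exercise 1, second part: `F*(C_G(F(G))) = Z(F(G)) E(G)`** (with `Z(F(G))` viewed in
`G` as `F(G) ∩ C_G(F(G))`, cf. `inf_centralizer_eq_map_center`).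
[cite: KurzweilStellmacher2004, §6.5 Exercise 1, p. 144] -/
theorem map_subtype_generalizedFittingSubgroup_centralizer_fittingSubgroup [Finite G] :
    (generalizedFittingSubgroup (Subgroup.centralizer (fittingSubgroup G : Set G))).map
        (Subgroup.centralizer (fittingSubgroup G : Set G)).subtype =
      (fittingSubgroup G ⊓ Subgroup.centralizer (fittingSubgroup G : Set G)) ⊔ layer G := by
  haveI := fittingSubgroup_normal (G := G)
  haveI : (Subgroup.centralizer (fittingSubgroup G : Set G)).Normal := Subgroup.normal_centralizer
  rw [← inf_generalizedFittingSubgroup_eq_map]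
  apply le_antisymm
  · -- `C ∩ F(G)E(G) = (C ∩ F(G)) E(G)` (Dedekind, `E(G) ≤ C`)
    intro x hx
    obtain ⟨hxC, hxF⟩ := Subgroup.mem_inf.mp hx
    rw [← SetLike.mem_coe, coe_generalizedFittingSubgroup] at hxF
    obtain ⟨f, hf, e, he, rfl⟩ := Set.mem_mul.mp hxF
    have hfC : f ∈ Subgroup.centralizer (fittingSubgroup G : Set G) := by
      have h := mul_mem hxC (inv_mem (layer_le_centralizer_fittingSubgroup he))
      rwa [mul_inv_cancel_right] at h
    exact mul_mem (Subgroup.mem_sup_left (Subgroup.mem_inf.mpr ⟨hf, hfC⟩))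
      (Subgroup.mem_sup_right he)
  · refine sup_le (le_inf inf_le_right (inf_le_left.trans ?_))
      (le_inf layer_le_centralizer_fittingSubgroup ?_)
    · show fittingSubgroup G ≤ fittingSubgroup G ⊔ layer G
      exact le_sup_left
    · show layer G ≤ fittingSubgroup G ⊔ layer G
      exact le_sup_right

/-- **§6.5 Exercise 1, second part with `Z(F(G))` as the centre**:
`F*(C_G(F(G))) = Z(F(G)) E(G)`. [cite: KurzweilStellmacher2004, §6.5 Exercise 1, p. 144] -/
theorem map_subtype_generalizedFittingSubgroup_centralizer_fittingSubgroup' [Finite G] :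
    (generalizedFittingSubgroup (Subgroup.centralizer (fittingSubgroup G : Set G))).map
        (Subgroup.centralizer (fittingSubgroup G : Set G)).subtype =
      (Subgroup.center (fittingSubgroup G)).map (fittingSubgroup G).subtype ⊔ layer G := by
  rw [map_subtype_generalizedFittingSubgroup_centralizer_fittingSubgroup,
    inf_centralizer_eq_map_center]

end Literature.GroupTheory.Solvable
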